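import Summits.QuantumFields.YangMills.Theorems.UnitScaleTiltProp7TorusGreenConvolution
import HarnessLib

/-!
# Route `UnitScaleTilt`, crux K1 «MinimiserStabilityRegPr» (stmt-QuantumFields-19200), route-R E′ path (α′), (E1-b)-cov ∕ (N-cov) near-field transplant — FLAT-CONV letters, FILE 2b:
# TORUS-GREEN CONVOLUTION BOUNDS, THE DECAYING KERNELS `a = 2` AND `a = 1` against an `r⁻²` density in an `R`-ball: `Σ_z |k z|·w z ≤ 3136·c·A∕(1 ∨ ρ)` (a = 2) and
# the LOG-FREE `≤ 1500·c·A·√(3R∕(1 ∨ ρ))` (a = 1), `ρ = tdist(x,y₀) ≤ 2R`, d = 3 (routeR-w6 g6's Q1 list, 2026-08-28T22:12Z)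

Cell `ym3-torus`, D-0154 (3c) twin-width seat `ym-routeR-w3` (gen 6); «FLAT-CONV — MINE».  Continuation of ✓∕⧗ `…TorusGreenConvolution` (FILE 2a: helpers, split geometry, a = 0, −1) over
✓ `Prop7TorusRadialSums` (FILE 1).  THEOREMS ONLY (0 `def`, 0 `sorry`); `--supports stmt-QuantumFields-19200`, count-neutral.  YM₃ on T³ is a ladder rung (R3), not the Clay problem;
nothing here claims the stub, the crux, d = 4 or the gap.

THE SPLIT: `ρ ≤ t_z + r_z` (`r_z := tdist(z,y₀)`, `t_z := tdist(z,x)`, `ρ := tdist(x,y₀)`) ⇒ `z ∈ A := {r_z ≤ t_z}` (kernel small) or `B := {t_z < r_z}` (density small); each halved at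
`h := ⌊ρ∕2⌋` (inner halves: radial sums up to `h` against the frozen factor; outer halves: tails ✓ `sum_inv_tdist_pow_four_le` ∕ ✓ `sum_inv_cube_tail_le_sqrt`).  Both theorems carry a
decl-local `maxHeartbeats 400000` (four regions in one declaration; passes at 300000 on the farm).

WHAT IS PROVED (ns `…Theorems.Prop7TorusGreenConvolutionDecay`; torus `Site P j`, `P.d = 3`, weight `0 ≤ w ≤ A·(1 ∨ tdist(·,y₀))⁻²` vanishing off the `R`-ball, `tdist(x,y₀) ≤ 2R`).
* ★★★ `conv_inv_sq_le` — kernel row `|k z| ≤ c·(1 ∨ tdist(z,x))⁻²` ⇒ `Σ_z |k z|·w z ≤ 3136·c·A∕(1 ∨ tdist(x,y₀))`.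
* ★★★ `conv_inv_le` — kernel row `|k z| ≤ c·(1 ∨ tdist(z,x))⁻¹`, `1 ≤ R` ⇒ `Σ_z |k z|·w z ≤ 1500·c·A·√(3R∕(1 ∨ tdist(x,y₀)))`.
(Vector-valued densities: ✓ `Prop7TorusGreenConvolution.norm_sum_smul_le_of_conv`.)
HONEST SCOPE.  Counting only; the kernel rows are DISPLAYED (suppliers ✓p659194 ∇G̃₁ (a = 2), ✓p667495 G̃₁ size and ✓p662832-type ∇²G̃₂ (a = 1), via ✓p662720 `tdist² ≤ d·Σz̃²`); constants crude and ours.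

References: G. F. Lawler, V. Limic, *Random Walk: A Modern Introduction*, CUP 2010, §6.3 [LawlerLimic2010] (orientation); T. Bałaban, CMP 99 (1985) 75–102 [Balaban1985RegularSpaces] ((1.36) p.82).
-/

set_option autoImplicit false

noncomputable section

open scoped BigOperators
open Finset

namespace Summit.QuantumFields.YangMills.Theorems.Prop7TorusGreenConvolutionDecay

open Literature.MathematicalPhysics.QuantumFieldTheory.Balaban1983to89
open B3Taylor310LocalRemainder (tdist_comm tdist_triangle tdist_self)
open Summit.QuantumFields.YangMills.Theorems.Prop7TorusRadialSums
open Summit.QuantumFields.YangMills.Theorems.Prop7TorusGreenConvolution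

variable {P : Params} {j : ℕ}

section Conv

variable (y₀ x : Site P j) (R : ℕ) (k w : Site P j → ℝ) {c A : ℝ}

set_option maxHeartbeats 400000 in
/-- ★★★ **a = 2 (e.g. `∇G̃₁ = ∇ΔG̃₂`)**: kernel row `|k z| ≤ c·(1 ∨ tdist(z,x))⁻²`, density `0 ≤ w ≤ A·(1 ∨ tdist(z,y₀))⁻²` on the `R`-ball (zero off it), `tdist(x,y₀) ≤ 2R`, `1 ≤ R` ⇒
`Σ_z |k z|·w z ≤ 3136·c·A∕(1 ∨ tdist(x,y₀))`. [cite: Balaban1985RegularSpaces, (1.36) p.82] -/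
theorem conv_inv_sq_le (hd : P.d = 3) (hx : Site.tdist x y₀ ≤ 2 * R) (hc : 0 ≤ c) (hA : 0 ≤ A)
    (hk : ∀ z, |k z| ≤ c / (max 1 ((Site.tdist z x : ℕ) : ℝ)) ^ 2) (hw : ∀ z, 0 ≤ w z)
    (hwA : ∀ z, w z ≤ A / (max 1 ((Site.tdist z y₀ : ℕ) : ℝ)) ^ 2) (hw0 : ∀ z, R < Site.tdist z y₀ → w z = 0) :
    ∑ z, |k z| * w z ≤ 3136 * c * A / max 1 ((Site.tdist x y₀ : ℕ) : ℝ) := by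
  classical
  rw [sum_eq_sum_ball y₀ R k w hw0]
  set S := (univ : Finset (Site P j)).filter (fun z => Site.tdist z y₀ ≤ R) with hSdef
  have hS : ∀ z ∈ S, Site.tdist z y₀ ≤ R := fun z hz => (Finset.mem_filter.mp hz).2
  set ρn : ℕ := Site.tdist x y₀ with hρn
  set h : ℕ := ρn / 2 with hh
  set Pm : ℝ := max 1 ((ρn : ℕ) : ℝ) with hPm
  have hP1 : 1 ≤ Pm := le_max_left _ _
  have hP0 : 0 < Pm := by linarith
  have hPρ : ((ρn : ℕ) : ℝ) ≤ Pm := le_max_right _ _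
  have hPh : Pm ≤ 2 * (((h : ℕ) : ℝ) + 1) := max_rho_le_two_half_add_one y₀ x
  have hh1 : (1 : ℝ) ≤ ((h : ℕ) : ℝ) + 1 := by have : (0 : ℝ) ≤ ((h : ℕ) : ℝ) := Nat.cast_nonneg _; linarith
  have hhρ : (((h : ℕ) : ℝ)) ≤ ((ρn : ℕ) : ℝ) / 2 := by
    have : 2 * h ≤ ρn := by omega
    have : (2 : ℝ) * ((h : ℕ) : ℝ) ≤ ((ρn : ℕ) : ℝ) := by exact_mod_cast this
    linarith
  have hcA : 0 ≤ c * A := mul_nonneg hc hA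
  have hnn : ∀ z, 0 ≤ |k z| * w z := fun z => mul_nonneg (abs_nonneg _) (hw z)
  -- the four regions
  set SA := S.filter (fun z => Site.tdist z y₀ ≤ Site.tdist z x) with hSA
  set SB := S.filter (fun z => ¬ Site.tdist z y₀ ≤ Site.tdist z x) with hSB
  set A₁ := SA.filter (fun z => Site.tdist z y₀ ≤ h) with hA₁def
  set A₂ := SA.filter (fun z => ¬ Site.tdist z y₀ ≤ h) with hA₂def
  set B₁ := SB.filter (fun z => Site.tdist z x ≤ h) with hB₁def
  set B₂ := SB.filter (fun z => ¬ Site.tdist z x ≤ h) with hB₂def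
  have hsplit : ∑ z ∈ S, |k z| * w z = (∑ z ∈ A₁, |k z| * w z + ∑ z ∈ A₂, |k z| * w z) + (∑ z ∈ B₁, |k z| * w z + ∑ z ∈ B₂, |k z| * w z) := by
    rw [← Finset.sum_filter_add_sum_filter_not S (fun z => Site.tdist z y₀ ≤ Site.tdist z x),
      ← Finset.sum_filter_add_sum_filter_not SA (fun z => Site.tdist z y₀ ≤ h),
      ← Finset.sum_filter_add_sum_filter_not SB (fun z => Site.tdist z x ≤ h)]
  -- A₁: kernel frozen at `4c/P²`, density summed radially up to `h`
  have hA₁ : ∑ z ∈ A₁, |k z| * w z ≤ 416 * c * A / Pm := by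
    have hpt : ∀ z ∈ A₁, |k z| * w z ≤ (4 * c / Pm ^ 2) * (A * ((max 1 ((Site.tdist z y₀ : ℕ) : ℝ)) ^ 2)⁻¹) := by
      intro z hz
      have hz' := (mem_of_mem_filter_filter hz).2
      have hm := max_rho_le_two_max_of_le y₀ x z hz'.1
      have hmt0 : 0 < max 1 ((Site.tdist z x : ℕ) : ℝ) := by positivity
      have hk1 : |k z| ≤ 4 * c / Pm ^ 2 := by
        refine (hk z).trans ?_
        rw [div_le_div_iff₀ (by positivity) (by positivity)]
        have : Pm ^ 2 ≤ 4 * (max 1 ((Site.tdist z x : ℕ) : ℝ)) ^ 2 := by nlinarith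
        nlinarith
      calc |k z| * w z ≤ (4 * c / Pm ^ 2) * (A / (max 1 ((Site.tdist z y₀ : ℕ) : ℝ)) ^ 2) := mul_le_mul hk1 (hwA z) (hw z) (by positivity)
        _ = _ := by rw [div_eq_mul_inv A]
    have hA₁S : ∀ z ∈ A₁, Site.tdist z y₀ ≤ h := fun z hz => (mem_of_mem_filter_filter hz).2.2
    calc ∑ z ∈ A₁, |k z| * w z ≤ ∑ z ∈ A₁, (4 * c / Pm ^ 2) * (A * ((max 1 ((Site.tdist z y₀ : ℕ) : ℝ)) ^ 2)⁻¹) := Finset.sum_le_sum hpt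
      _ = (4 * c / Pm ^ 2) * A * ∑ z ∈ A₁, ((max 1 ((Site.tdist z y₀ : ℕ) : ℝ)) ^ 2)⁻¹ := by rw [Finset.mul_sum]; exact Finset.sum_congr rfl fun z _ => by ring
      _ ≤ (4 * c / Pm ^ 2) * A * (8 + 192 * ((h : ℕ) : ℝ)) := mul_le_mul_of_nonneg_left (sum_inv_max_sq_le hd A₁ y₀ h hA₁S) (by positivity)
      _ ≤ (4 * c / Pm ^ 2) * A * (104 * Pm) := by
          refine mul_le_mul_of_nonneg_left ?_ (by positivity)
          nlinarith
      _ = 416 * c * A / Pm := by field_simp; ring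
  -- A₂: kernel `≤ c/r²` (since `t ≥ r`), density `≤ A/r²`, tail `Σ_{r>h} r⁻⁴ ≤ 576/(h+1)`
  have hA₂ : ∑ z ∈ A₂, |k z| * w z ≤ 1152 * c * A / Pm := by
    by_cases hne : A₂.Nonempty
    · have hA₂S : ∀ z ∈ A₂, h + 1 ≤ Site.tdist z y₀ ∧ Site.tdist z y₀ ≤ R := fun z hz => by
        have hz' := mem_of_mem_filter_filter hz
        have hz3 := hz'.2.2
        exact ⟨by omega, hS z hz'.1⟩
      have hMN : h + 1 ≤ R := by obtain ⟨z, hz⟩ := hne; have := hA₂S z hz; omega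
      have hpt : ∀ z ∈ A₂, |k z| * w z ≤ c * A * ((((Site.tdist z y₀ : ℕ) : ℝ)) ^ 4)⁻¹ := by
        intro z hz
        have hz' := (mem_of_mem_filter_filter hz).2
        have hz'' := hz'.2
        have hr1 : (1 : ℝ) ≤ ((Site.tdist z y₀ : ℕ) : ℝ) := by exact_mod_cast (show 1 ≤ Site.tdist z y₀ by omega)
        have hrt : ((Site.tdist z y₀ : ℕ) : ℝ) ≤ ((Site.tdist z x : ℕ) : ℝ) := by exact_mod_cast hz'.1
        set r : ℝ := ((Site.tdist z y₀ : ℕ) : ℝ) with hr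
        have hr0 : 0 < r := by linarith
        have hmr : max 1 r = r := max_eq_right hr1
        have hmt : r ≤ max 1 ((Site.tdist z x : ℕ) : ℝ) := hrt.trans (le_max_right _ _)
        have hk1 : |k z| ≤ c / r ^ 2 := (hk z).trans (div_le_div_of_nonneg_left hc (by positivity) (pow_le_pow_left₀ hr0.le hmt 2))
        have hw1 : w z ≤ A / r ^ 2 := by rw [← hmr]; exact hwA z
        calc |k z| * w z ≤ (c / r ^ 2) * (A / r ^ 2) := mul_le_mul hk1 hw1 (hw z) (by positivity)
          _ = c * A * (r ^ 4)⁻¹ := by rw [div_mul_div_comm, div_eq_mul_inv]; ring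
      calc ∑ z ∈ A₂, |k z| * w z ≤ ∑ z ∈ A₂, c * A * ((((Site.tdist z y₀ : ℕ) : ℝ)) ^ 4)⁻¹ := Finset.sum_le_sum hpt
        _ = c * A * ∑ z ∈ A₂, ((((Site.tdist z y₀ : ℕ) : ℝ)) ^ 4)⁻¹ := by rw [Finset.mul_sum]
        _ ≤ c * A * (576 / ((h + 1 : ℕ) : ℝ)) := mul_le_mul_of_nonneg_left (sum_inv_tdist_pow_four_le hd A₂ y₀ (by omega) hMN hA₂S) hcA
        _ ≤ c * A * (1152 / Pm) := by
            refine mul_le_mul_of_nonneg_left ?_ hcA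
            push_cast
            rw [div_le_div_iff₀ (by linarith) hP0]
            nlinarith
        _ = 1152 * c * A / Pm := by ring
    · rw [Finset.not_nonempty_iff_eq_empty.mp hne, Finset.sum_empty]
      exact div_nonneg (mul_nonneg (mul_nonneg (by norm_num) hc) hA) hP0.le
  -- B₁: density frozen at `4A/P²`, kernel summed radially (around x) up to `h`
  have hB₁ : ∑ z ∈ B₁, |k z| * w z ≤ 416 * c * A / Pm := by
    have hpt : ∀ z ∈ B₁, |k z| * w z ≤ (c * ((max 1 ((Site.tdist z x : ℕ) : ℝ)) ^ 2)⁻¹) * (4 * A / Pm ^ 2) := by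
      intro z hz
      have hz' := (mem_of_mem_filter_filter hz).2
      have hm := max_rho_le_two_max_of_lt y₀ x z (not_le.mp hz'.1)
      have hmr0 : 0 < max 1 ((Site.tdist z y₀ : ℕ) : ℝ) := by positivity
      have hw1 : w z ≤ 4 * A / Pm ^ 2 := by
        refine (hwA z).trans ?_
        rw [div_le_div_iff₀ (by positivity) (by positivity)]
        have : Pm ^ 2 ≤ 4 * (max 1 ((Site.tdist z y₀ : ℕ) : ℝ)) ^ 2 := by nlinarith
        nlinarith
      calc |k z| * w z ≤ (c / (max 1 ((Site.tdist z x : ℕ) : ℝ)) ^ 2) * (4 * A / Pm ^ 2) := mul_le_mul (hk z) hw1 (hw z) (by positivity)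
        _ = _ := by rw [div_eq_mul_inv c]
    have hB₁S : ∀ z ∈ B₁, Site.tdist z x ≤ h := fun z hz => (mem_of_mem_filter_filter hz).2.2
    calc ∑ z ∈ B₁, |k z| * w z ≤ ∑ z ∈ B₁, (c * ((max 1 ((Site.tdist z x : ℕ) : ℝ)) ^ 2)⁻¹) * (4 * A / Pm ^ 2) := Finset.sum_le_sum hpt
      _ = (4 * A / Pm ^ 2) * c * ∑ z ∈ B₁, ((max 1 ((Site.tdist z x : ℕ) : ℝ)) ^ 2)⁻¹ := by rw [Finset.mul_sum]; exact Finset.sum_congr rfl fun z _ => by ring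
      _ ≤ (4 * A / Pm ^ 2) * c * (8 + 192 * ((h : ℕ) : ℝ)) := mul_le_mul_of_nonneg_left (sum_inv_max_sq_le hd B₁ x h hB₁S) (by positivity)
      _ ≤ (4 * A / Pm ^ 2) * c * (104 * Pm) := by
          refine mul_le_mul_of_nonneg_left ?_ (by positivity)
          nlinarith
      _ = 416 * c * A / Pm := by field_simp; ring
  -- B₂: kernel `≤ c/t²`, density `≤ A/t²` (since `r > t`), tail around x
  have hB₂ : ∑ z ∈ B₂, |k z| * w z ≤ 1152 * c * A / Pm := by
    by_cases hne : B₂.Nonempty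
    · have hB₂S : ∀ z ∈ B₂, h + 1 ≤ Site.tdist z x ∧ Site.tdist z x ≤ 3 * R := fun z hz => by
        have hz' := mem_of_mem_filter_filter hz
        have hz3 := hz'.2.2
        have h1 := tdist_triangle z y₀ x
        rw [tdist_comm y₀ x] at h1
        have h2 := hS z hz'.1
        exact ⟨by omega, by omega⟩
      have hMN : h + 1 ≤ 3 * R := by obtain ⟨z, hz⟩ := hne; have := hB₂S z hz; omega
      have hpt : ∀ z ∈ B₂, |k z| * w z ≤ c * A * ((((Site.tdist z x : ℕ) : ℝ)) ^ 4)⁻¹ := by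
        intro z hz
        have hz' := (mem_of_mem_filter_filter hz).2
        have hz'' := hz'.2
        have ht1 : (1 : ℝ) ≤ ((Site.tdist z x : ℕ) : ℝ) := by exact_mod_cast (show 1 ≤ Site.tdist z x by omega)
        have htr : ((Site.tdist z x : ℕ) : ℝ) ≤ ((Site.tdist z y₀ : ℕ) : ℝ) := by exact_mod_cast (not_le.mp hz'.1).le
        set t : ℝ := ((Site.tdist z x : ℕ) : ℝ) with ht
        have ht0 : 0 < t := by linarith
        have hmt : max 1 t = t := max_eq_right ht1
        have hmr : t ≤ max 1 ((Site.tdist z y₀ : ℕ) : ℝ) := htr.trans (le_max_right _ _)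
        have hk1 : |k z| ≤ c / t ^ 2 := by rw [← hmt]; exact hk z
        have hw1 : w z ≤ A / t ^ 2 := (hwA z).trans (div_le_div_of_nonneg_left hA (by positivity) (pow_le_pow_left₀ ht0.le hmr 2))
        calc |k z| * w z ≤ (c / t ^ 2) * (A / t ^ 2) := mul_le_mul hk1 hw1 (hw z) (by positivity)
          _ = c * A * (t ^ 4)⁻¹ := by rw [div_mul_div_comm, div_eq_mul_inv]; ring
      calc ∑ z ∈ B₂, |k z| * w z ≤ ∑ z ∈ B₂, c * A * ((((Site.tdist z x : ℕ) : ℝ)) ^ 4)⁻¹ := Finset.sum_le_sum hpt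
        _ = c * A * ∑ z ∈ B₂, ((((Site.tdist z x : ℕ) : ℝ)) ^ 4)⁻¹ := by rw [Finset.mul_sum]
        _ ≤ c * A * (576 / ((h + 1 : ℕ) : ℝ)) := mul_le_mul_of_nonneg_left (sum_inv_tdist_pow_four_le hd B₂ x (by omega) hMN hB₂S) hcA
        _ ≤ c * A * (1152 / Pm) := by
            refine mul_le_mul_of_nonneg_left ?_ hcA
            push_cast
            rw [div_le_div_iff₀ (by linarith) hP0]
            nlinarith
        _ = 1152 * c * A / Pm := by ring
    · rw [Finset.not_nonempty_iff_eq_empty.mp hne, Finset.sum_empty]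
      exact div_nonneg (mul_nonneg (mul_nonneg (by norm_num) hc) hA) hP0.le
  rw [hsplit]
  have e : 3136 * c * A / Pm = (416 * c * A / Pm + 1152 * c * A / Pm) + (416 * c * A / Pm + 1152 * c * A / Pm) := by ring
  rw [e]
  exact add_le_add (add_le_add hA₁ hA₂) (add_le_add hB₁ hB₂)

set_option maxHeartbeats 400000 in
/-- ★★★ **a = 1 (e.g. G̃₁ size, `∇²G̃₂`)**: kernel row `|k z| ≤ c·(1 ∨ tdist(z,x))⁻¹`, density as above ⇒ LOG-FREE
`Σ_z |k z|·w z ≤ 1500·c·A·√(3R∕(1 ∨ tdist(x,y₀)))`. [cite: Balaban1985RegularSpaces, (1.36) p.82] -/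
theorem conv_inv_le (hd : P.d = 3) (hR : 1 ≤ R) (hx : Site.tdist x y₀ ≤ 2 * R) (hc : 0 ≤ c) (hA : 0 ≤ A)
    (hk : ∀ z, |k z| ≤ c / max 1 ((Site.tdist z x : ℕ) : ℝ)) (hw : ∀ z, 0 ≤ w z)
    (hwA : ∀ z, w z ≤ A / (max 1 ((Site.tdist z y₀ : ℕ) : ℝ)) ^ 2) (hw0 : ∀ z, R < Site.tdist z y₀ → w z = 0) :
    ∑ z, |k z| * w z ≤ 1500 * c * A * Real.sqrt (3 * (R : ℝ) / max 1 ((Site.tdist x y₀ : ℕ) : ℝ)) := by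
  classical
  rw [sum_eq_sum_ball y₀ R k w hw0]
  set S := (univ : Finset (Site P j)).filter (fun z => Site.tdist z y₀ ≤ R) with hSdef
  have hS : ∀ z ∈ S, Site.tdist z y₀ ≤ R := fun z hz => (Finset.mem_filter.mp hz).2
  set ρn : ℕ := Site.tdist x y₀ with hρn
  set h : ℕ := ρn / 2 with hh
  set Pm : ℝ := max 1 ((ρn : ℕ) : ℝ) with hPm
  have hP1 : 1 ≤ Pm := le_max_left _ _
  have hP0 : 0 < Pm := by linarith
  have hPρ : ((ρn : ℕ) : ℝ) ≤ Pm := le_max_right _ _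
  have hPh : Pm ≤ 2 * (((h : ℕ) : ℝ) + 1) := max_rho_le_two_half_add_one y₀ x
  have hhρ : (((h : ℕ) : ℝ)) ≤ ((ρn : ℕ) : ℝ) / 2 := by
    have : 2 * h ≤ ρn := by omega
    have : (2 : ℝ) * ((h : ℕ) : ℝ) ≤ ((ρn : ℕ) : ℝ) := by exact_mod_cast this
    linarith
  have hR1 : (1 : ℝ) ≤ R := by exact_mod_cast hR
  have hPR : Pm ≤ 3 * (R : ℝ) := max_le (by linarith) (by exact_mod_cast (show ρn ≤ 3 * R by omega))
  have hcA : 0 ≤ c * A := mul_nonneg hc hA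
  -- the log-free majorant `Q := √(3R / P) ≥ 1`
  set Q : ℝ := Real.sqrt (3 * (R : ℝ) / Pm) with hQ
  have hQ1 : 1 ≤ Q := by
    rw [hQ, Real.le_sqrt' one_pos, one_pow, le_div_iff₀ hP0, one_mul]
    exact hPR
  have hQ0 : 0 ≤ Q := by linarith
  -- `√N/√(h+1) ≤ √2·… ≤ 3Q/2` bookkeeping: `(h+1) ≥ P/2` ⇒ `N/(h+1) ≤ 2N/P`; we use `√(R/(h+1)) ≤ Q` and `√(3R/(h+1)) ≤ 3Q/2`
  have hh1 : (0 : ℝ) < ((h : ℕ) : ℝ) + 1 := by have : (0 : ℝ) ≤ ((h : ℕ) : ℝ) := Nat.cast_nonneg _; linarith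
  have hsq1 : Real.sqrt (R : ℝ) / Real.sqrt (((h + 1 : ℕ) : ℝ)) ≤ Q := by
    push_cast
    rw [← Real.sqrt_div' _ hh1.le, hQ]
    · refine Real.sqrt_le_sqrt ?_
      rw [div_le_div_iff₀ hh1 hP0]
      nlinarith
  have hsq3 : Real.sqrt ((3 * R : ℕ) : ℝ) / Real.sqrt (((h + 1 : ℕ) : ℝ)) ≤ 3 / 2 * Q := by
    push_cast
    rw [← Real.sqrt_div' _ hh1.le, hQ]
    · have e : (3 : ℝ) / 2 * Real.sqrt (3 * (R : ℝ) / Pm) = Real.sqrt ((3 / 2) ^ 2 * (3 * (R : ℝ) / Pm)) := by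
        rw [Real.sqrt_mul' _ (by positivity), Real.sqrt_sq (by norm_num)]
      rw [e]
      refine Real.sqrt_le_sqrt ?_
      rw [div_le_iff₀ hh1]
      have : 3 * (R : ℝ) / Pm * (((h : ℕ) : ℝ) + 1) ≥ 3 * (R : ℝ) / 2 := by
        rw [ge_iff_le, div_le_iff₀ (by norm_num : (0:ℝ) < 2)]
        have e2 : 3 * (R : ℝ) / Pm * (((h : ℕ) : ℝ) + 1) * 2 = 3 * (R : ℝ) * (2 * (((h : ℕ) : ℝ) + 1)) / Pm := by ring
        rw [e2, le_div_iff₀ hP0]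
        nlinarith
      nlinarith
  have hnn : ∀ z, 0 ≤ |k z| * w z := fun z => mul_nonneg (abs_nonneg _) (hw z)
  set SA := S.filter (fun z => Site.tdist z y₀ ≤ Site.tdist z x) with hSA
  set SB := S.filter (fun z => ¬ Site.tdist z y₀ ≤ Site.tdist z x) with hSB
  set A₁ := SA.filter (fun z => Site.tdist z y₀ ≤ h) with hA₁def
  set A₂ := SA.filter (fun z => ¬ Site.tdist z y₀ ≤ h) with hA₂def
  set B₁ := SB.filter (fun z => Site.tdist z x ≤ h) with hB₁def
  set B₂ := SB.filter (fun z => ¬ Site.tdist z x ≤ h) with hB₂def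
  have hsplit : ∑ z ∈ S, |k z| * w z = (∑ z ∈ A₁, |k z| * w z + ∑ z ∈ A₂, |k z| * w z) + (∑ z ∈ B₁, |k z| * w z + ∑ z ∈ B₂, |k z| * w z) := by
    rw [← Finset.sum_filter_add_sum_filter_not S (fun z => Site.tdist z y₀ ≤ Site.tdist z x),
      ← Finset.sum_filter_add_sum_filter_not SA (fun z => Site.tdist z y₀ ≤ h),
      ← Finset.sum_filter_add_sum_filter_not SB (fun z => Site.tdist z x ≤ h)]
  -- A₁: kernel frozen at `2c/P`, density mass `≤ A(8 + 192h) ≤ 104·A·P`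
  have hA₁ : ∑ z ∈ A₁, |k z| * w z ≤ 208 * c * A := by
    have hpt : ∀ z ∈ A₁, |k z| * w z ≤ (2 * c / Pm) * (A * ((max 1 ((Site.tdist z y₀ : ℕ) : ℝ)) ^ 2)⁻¹) := by
      intro z hz
      have hz' := (mem_of_mem_filter_filter hz).2
      have hm := max_rho_le_two_max_of_le y₀ x z hz'.1
      have hmt0 : 0 < max 1 ((Site.tdist z x : ℕ) : ℝ) := by positivity
      have hk1 : |k z| ≤ 2 * c / Pm := by
        refine (hk z).trans ?_
        rw [div_le_div_iff₀ hmt0 hP0]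
        nlinarith
      calc |k z| * w z ≤ (2 * c / Pm) * (A / (max 1 ((Site.tdist z y₀ : ℕ) : ℝ)) ^ 2) := mul_le_mul hk1 (hwA z) (hw z) (by positivity)
        _ = _ := by rw [div_eq_mul_inv A]
    have hA₁S : ∀ z ∈ A₁, Site.tdist z y₀ ≤ h := fun z hz => (mem_of_mem_filter_filter hz).2.2
    calc ∑ z ∈ A₁, |k z| * w z ≤ ∑ z ∈ A₁, (2 * c / Pm) * (A * ((max 1 ((Site.tdist z y₀ : ℕ) : ℝ)) ^ 2)⁻¹) := Finset.sum_le_sum hpt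
      _ = (2 * c / Pm) * A * ∑ z ∈ A₁, ((max 1 ((Site.tdist z y₀ : ℕ) : ℝ)) ^ 2)⁻¹ := by rw [Finset.mul_sum]; exact Finset.sum_congr rfl fun z _ => by ring
      _ ≤ (2 * c / Pm) * A * (8 + 192 * ((h : ℕ) : ℝ)) := mul_le_mul_of_nonneg_left (sum_inv_max_sq_le hd A₁ y₀ h hA₁S) (by positivity)
      _ ≤ (2 * c / Pm) * A * (104 * Pm) := by
          refine mul_le_mul_of_nonneg_left ?_ (by positivity)
          nlinarith
      _ = 208 * c * A := by field_simp; ring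
  -- A₂: `c/r · A/r²`, tail `Σ_{h<r≤R} r⁻³ ≤ 64 + 384 √R/√(h+1) ≤ 64 + 384 Q`
  have hA₂ : ∑ z ∈ A₂, |k z| * w z ≤ c * A * (64 + 384 * Q) := by
    by_cases hne : A₂.Nonempty
    · have hA₂S : ∀ z ∈ A₂, h + 1 ≤ Site.tdist z y₀ ∧ Site.tdist z y₀ ≤ R := fun z hz => by
        have hz' := mem_of_mem_filter_filter hz
        have hz3 := hz'.2.2
        exact ⟨by omega, hS z hz'.1⟩
      have hMN : h + 1 ≤ R := by obtain ⟨z, hz⟩ := hne; have := hA₂S z hz; omega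
      have hpt : ∀ z ∈ A₂, |k z| * w z ≤ c * A * ((((Site.tdist z y₀ : ℕ) : ℝ)) ^ 3)⁻¹ := by
        intro z hz
        have hz' := (mem_of_mem_filter_filter hz).2
        have hz'' := hz'.2
        have hr1 : (1 : ℝ) ≤ ((Site.tdist z y₀ : ℕ) : ℝ) := by exact_mod_cast (show 1 ≤ Site.tdist z y₀ by omega)
        have hrt : ((Site.tdist z y₀ : ℕ) : ℝ) ≤ ((Site.tdist z x : ℕ) : ℝ) := by exact_mod_cast hz'.1
        set r : ℝ := ((Site.tdist z y₀ : ℕ) : ℝ) with hr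
        have hr0 : 0 < r := by linarith
        have hmr : max 1 r = r := max_eq_right hr1
        have hmt : r ≤ max 1 ((Site.tdist z x : ℕ) : ℝ) := hrt.trans (le_max_right _ _)
        have hk1 : |k z| ≤ c / r := (hk z).trans (div_le_div_of_nonneg_left hc hr0 hmt)
        have hw1 : w z ≤ A / r ^ 2 := by rw [← hmr]; exact hwA z
        calc |k z| * w z ≤ (c / r) * (A / r ^ 2) := mul_le_mul hk1 hw1 (hw z) (by positivity)
          _ = c * A * (r ^ 3)⁻¹ := by rw [div_mul_div_comm, div_eq_mul_inv]; ring
      calc ∑ z ∈ A₂, |k z| * w z ≤ ∑ z ∈ A₂, c * A * ((((Site.tdist z y₀ : ℕ) : ℝ)) ^ 3)⁻¹ := Finset.sum_le_sum hpt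
        _ = c * A * ∑ z ∈ A₂, ((((Site.tdist z y₀ : ℕ) : ℝ)) ^ 3)⁻¹ := by rw [Finset.mul_sum]
        _ ≤ c * A * (64 + 384 * (Real.sqrt R / Real.sqrt ((h + 1 : ℕ) : ℝ))) :=
            mul_le_mul_of_nonneg_left (sum_inv_cube_tail_le_sqrt hd A₂ y₀ (by omega) hMN hA₂S) hcA
        _ ≤ c * A * (64 + 384 * Q) := by
            refine mul_le_mul_of_nonneg_left ?_ hcA
            linarith [hsq1]
    · rw [Finset.not_nonempty_iff_eq_empty.mp hne, Finset.sum_empty]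
      exact mul_nonneg hcA (by nlinarith [hQ0])
  -- B₁: density frozen at `4A/P²`, kernel mass `Σ_{t≤h} (1∨t)⁻¹ ≤ 8 + 128h² ≤ 8 + 32ρ² ≤ 40P²`
  have hB₁ : ∑ z ∈ B₁, |k z| * w z ≤ 160 * c * A := by
    have hpt : ∀ z ∈ B₁, |k z| * w z ≤ (c * (max 1 ((Site.tdist z x : ℕ) : ℝ))⁻¹) * (4 * A / Pm ^ 2) := by
      intro z hz
      have hz' := (mem_of_mem_filter_filter hz).2
      have hm := max_rho_le_two_max_of_lt y₀ x z (not_le.mp hz'.1)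
      have hmr0 : 0 < max 1 ((Site.tdist z y₀ : ℕ) : ℝ) := by positivity
      have hw1 : w z ≤ 4 * A / Pm ^ 2 := by
        refine (hwA z).trans ?_
        rw [div_le_div_iff₀ (by positivity) (by positivity)]
        have : Pm ^ 2 ≤ 4 * (max 1 ((Site.tdist z y₀ : ℕ) : ℝ)) ^ 2 := by nlinarith
        nlinarith
      calc |k z| * w z ≤ (c / max 1 ((Site.tdist z x : ℕ) : ℝ)) * (4 * A / Pm ^ 2) := mul_le_mul (hk z) hw1 (hw z) (by positivity)
        _ = _ := by rw [div_eq_mul_inv c]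
    have hB₁S : ∀ z ∈ B₁, Site.tdist z x ≤ h := fun z hz => (mem_of_mem_filter_filter hz).2.2
    calc ∑ z ∈ B₁, |k z| * w z ≤ ∑ z ∈ B₁, (c * (max 1 ((Site.tdist z x : ℕ) : ℝ))⁻¹) * (4 * A / Pm ^ 2) := Finset.sum_le_sum hpt
      _ = (4 * A / Pm ^ 2) * c * ∑ z ∈ B₁, (max 1 ((Site.tdist z x : ℕ) : ℝ))⁻¹ := by rw [Finset.mul_sum]; exact Finset.sum_congr rfl fun z _ => by ring
      _ ≤ (4 * A / Pm ^ 2) * c * (8 + 128 * ((h : ℕ) : ℝ) ^ 2) := mul_le_mul_of_nonneg_left (sum_inv_max_le hd B₁ x h hB₁S) (by positivity)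
      _ ≤ (4 * A / Pm ^ 2) * c * (40 * Pm ^ 2) := by
          refine mul_le_mul_of_nonneg_left ?_ (by positivity)
          nlinarith
      _ = 160 * c * A := by field_simp; ring
  -- B₂: `c/t · A/t²` (since `r > t`), tail around x up to `3R`
  have hB₂ : ∑ z ∈ B₂, |k z| * w z ≤ c * A * (64 + 576 * Q) := by
    by_cases hne : B₂.Nonempty
    · have hB₂S : ∀ z ∈ B₂, h + 1 ≤ Site.tdist z x ∧ Site.tdist z x ≤ 3 * R := fun z hz => by
        have hz' := mem_of_mem_filter_filter hz
        have hz3 := hz'.2.2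
        have h1 := tdist_triangle z y₀ x
        rw [tdist_comm y₀ x] at h1
        have h2 := hS z hz'.1
        exact ⟨by omega, by omega⟩
      have hMN : h + 1 ≤ 3 * R := by obtain ⟨z, hz⟩ := hne; have := hB₂S z hz; omega
      have hpt : ∀ z ∈ B₂, |k z| * w z ≤ c * A * ((((Site.tdist z x : ℕ) : ℝ)) ^ 3)⁻¹ := by
        intro z hz
        have hz' := (mem_of_mem_filter_filter hz).2
        have hz'' := hz'.2
        have ht1 : (1 : ℝ) ≤ ((Site.tdist z x : ℕ) : ℝ) := by exact_mod_cast (show 1 ≤ Site.tdist z x by omega)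
        have htr : ((Site.tdist z x : ℕ) : ℝ) ≤ ((Site.tdist z y₀ : ℕ) : ℝ) := by exact_mod_cast (not_le.mp hz'.1).le
        set t : ℝ := ((Site.tdist z x : ℕ) : ℝ) with ht
        have ht0 : 0 < t := by linarith
        have hmt : max 1 t = t := max_eq_right ht1
        have hmr : t ≤ max 1 ((Site.tdist z y₀ : ℕ) : ℝ) := htr.trans (le_max_right _ _)
        have hk1 : |k z| ≤ c / t := by rw [← hmt]; exact hk z
        have hw1 : w z ≤ A / t ^ 2 := (hwA z).trans (div_le_div_of_nonneg_left hA (by positivity) (pow_le_pow_left₀ ht0.le hmr 2))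
        calc |k z| * w z ≤ (c / t) * (A / t ^ 2) := mul_le_mul hk1 hw1 (hw z) (by positivity)
          _ = c * A * (t ^ 3)⁻¹ := by rw [div_mul_div_comm, div_eq_mul_inv]; ring
      calc ∑ z ∈ B₂, |k z| * w z ≤ ∑ z ∈ B₂, c * A * ((((Site.tdist z x : ℕ) : ℝ)) ^ 3)⁻¹ := Finset.sum_le_sum hpt
        _ = c * A * ∑ z ∈ B₂, ((((Site.tdist z x : ℕ) : ℝ)) ^ 3)⁻¹ := by rw [Finset.mul_sum]
        _ ≤ c * A * (64 + 384 * (Real.sqrt ((3 * R : ℕ) : ℝ) / Real.sqrt ((h + 1 : ℕ) : ℝ))) :=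
            mul_le_mul_of_nonneg_left (sum_inv_cube_tail_le_sqrt hd B₂ x (by omega) hMN hB₂S) hcA
        _ ≤ c * A * (64 + 576 * Q) := by
            refine mul_le_mul_of_nonneg_left ?_ hcA
            linarith [hsq3]
    · rw [Finset.not_nonempty_iff_eq_empty.mp hne, Finset.sum_empty]
      exact mul_nonneg hcA (by nlinarith [hQ0])
  rw [hsplit]
  calc (∑ z ∈ A₁, |k z| * w z + ∑ z ∈ A₂, |k z| * w z) + (∑ z ∈ B₁, |k z| * w z + ∑ z ∈ B₂, |k z| * w z)
      ≤ (208 * c * A + c * A * (64 + 384 * Q)) + (160 * c * A + c * A * (64 + 576 * Q)) := add_le_add (add_le_add hA₁ hA₂) (add_le_add hB₁ hB₂)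
    _ = c * A * (496 + 960 * Q) := by ring
    _ ≤ c * A * (1500 * Q) := mul_le_mul_of_nonneg_left (by nlinarith) hcA
    _ = 1500 * c * A * Q := by ring

end Conv

end Summit.QuantumFields.YangMills.Theorems.Prop7TorusGreenConvolutionDecay

end
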